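import Literature.Analysis.SegalBargmann.HermiteMoments
import HarnessLib

/-!
# Finite Parseval for injectively indexed Hermite families; the `L²` size of `x_j F` (Folland 1989, §1.7)

Topic `Analysis/SegalBargmann`; namespace `Literature.Analysis.SegalBargmann`.  Continuation of
`Literature.Analysis.SegalBargmann.HermiteMoments`.  Bookkeeping for finite Hermite combinations indexed by an arbitrary
finite set through an injective multi-index map — the form in which the ladder/coordinate operators act
(`β ↦ β + 1_j` is injective; `β ↦ β − 1_j` is injective where the coefficient `√(β_j/π)` is non-zero):

* `bpair_sum_smul_herm_family` — `⟨Σ_i a_i h_{φ i}, Σ_i b_i h_{φ i}⟩ = Σ_i a_i b_i` for `φ` injective on the index set;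
* `integral_norm_sq_sum_smul_herm_family` — PARSEVAL `∫ ‖Σ_i c_i h_{φ i}‖² = Σ_i ‖c_i‖²` for such families;
* `coordMulCLM_sum_smul_herm` — `x_j (Σ_{β∈S} c_β h_β) = Σ_β c_β a⁺_β h_{β+1_j} + Σ_β c_β a⁻_β h_{β−1_j}` with
  `a⁺_β = ½√((β_j+1)/π)`, `a⁻_β = ½√(β_j/π)`, and the Parseval value of the RAISING piece
  (`integral_norm_sq_coordMul_up`): `Σ_β ‖c_β‖²(β_j+1)/(4π)`, at most `(d+1)/(4π) · Σ‖c_β‖²` when `β_j ≤ d` on `S`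
  (`integral_norm_sq_coordMul_up_le`).  The lowering piece (injective only on `{β_j ≥ 1}`, where its coefficient is
  non-zero) is treated in the sequel.

These are the coefficient-level estimates behind `‖x_j F‖₂ ≤ √((d+1)/π) ‖F‖₂` on the span of the Hermite functions of
degree `≤ d` (the weighted-`L²` growth bounds of the Hermite functions).  Everything is proved from Mathlib and the
imported tree files; no cited fact is used as a hypothesis.

## References

* G. B. Folland, *Harmonic Analysis in Phase Space*, Annals of Mathematics Studies 122, Princeton UP (1989), §1.7.
  [cite: Folland1989, §1.7]

## Provenance

Written for the tree under the LEAN-IN-TREE rule (2026-08-18) by the pub-hodgecm formalisation cell (model-construction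
sub-cell, seat mc-binder-2).
-/

set_option autoImplicit false

noncomputable section

open MvPolynomial Complex SchwartzMap MeasureTheory
open scoped BigOperators Real ComplexConjugate

namespace Literature.Analysis.SegalBargmann

variable {σ : Type*} [Fintype σ] [DecidableEq σ]

/-! ## §1  Pairing and Parseval for injectively indexed Hermite families -/

section Family

variable {ι : Type*} [DecidableEq ι] (S : Finset ι) (φ : ι → (σ →₀ ℕ))

/-- **`⟨Σ_i a_i h_{φ i}, Σ_i b_i h_{φ i}⟩ = Σ_i a_i b_i`** for a family of Hermite functions indexed INJECTIVELY on `S`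
(bilinear pairing; orthonormality). [cite: Folland1989, §1.7] -/
theorem bpair_sum_smul_herm_family (hφ : Set.InjOn φ S) (a b : ι → ℂ) :
    bpair (∑ i ∈ S, a i • hermiteSchwartz (herm (φ i))) (∑ i ∈ S, b i • hermiteSchwartz (herm (φ i))) =
      ∑ i ∈ S, a i * b i := by
  rw [bpair_sum_left]
  refine Finset.sum_congr rfl fun i hi => ?_
  rw [bpair_smul_left, bpair_sum_right]
  simp_rw [bpair_smul_right, bpair_herm_herm]
  have h : ∀ i' ∈ S, b i' * (if φ i = φ i' then (1 : ℂ) else 0) = if i = i' then b i else 0 := fun i' hi' => by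
    by_cases hii : i = i'
    · subst hii; simp
    · have : φ i ≠ φ i' := fun heq => hii (hφ hi hi' heq)
      simp [this, hii]
  rw [Finset.sum_congr rfl h, Finset.sum_ite_eq, if_pos hi]

/-- **Parseval for injectively indexed Hermite families**: `∫ ‖Σ_{i∈S} c_i h_{φ i}‖² = Σ_{i∈S} ‖c_i‖²`.
[cite: Folland1989, §1.7] -/
theorem integral_norm_sq_sum_smul_herm_family (hφ : Set.InjOn φ S) (c : ι → ℂ) :
    ∫ x : EuclideanSpace ℝ σ, ‖(∑ i ∈ S, c i • hermiteSchwartz (herm (φ i))) x‖ ^ 2 = ∑ i ∈ S, ‖c i‖ ^ 2 := by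
  set F : 𝓢(EuclideanSpace ℝ σ, ℂ) := ∑ i ∈ S, c i • hermiteSchwartz (herm (φ i)) with hF
  set G : 𝓢(EuclideanSpace ℝ σ, ℂ) := ∑ i ∈ S, conj (c i) • hermiteSchwartz (herm (φ i)) with hG
  have hconj : ∀ x, conj (F x) = G x := fun x => by
    rw [hF, hG, sum_apply, sum_apply, map_sum]
    refine Finset.sum_congr rfl fun i _ => ?_
    rw [smul_apply, smul_apply, smul_eq_mul, smul_eq_mul, map_mul, conj_hermiteSchwartz_herm]
  have hint : ((∫ x : EuclideanSpace ℝ σ, ‖F x‖ ^ 2 : ℝ) : ℂ) = bpair F G := by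
    rw [bpair_apply, ← integral_complex_ofReal]
    refine integral_congr_ae (Filter.Eventually.of_forall fun x => ?_)
    show ((‖F x‖ ^ 2 : ℝ) : ℂ) = F x * G x
    rw [← hconj, Complex.mul_conj, Complex.normSq_eq_norm_sq, Complex.ofReal_pow]
  have hexp : bpair F G = ∑ i ∈ S, c i * conj (c i) := bpair_sum_smul_herm_family S φ hφ c (fun i => conj (c i))
  have hreal : ((∑ i ∈ S, ‖c i‖ ^ 2 : ℝ) : ℂ) = ∑ i ∈ S, c i * conj (c i) := by
    push_cast
    refine Finset.sum_congr rfl fun i _ => ?_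
    rw [Complex.mul_conj, Complex.normSq_eq_norm_sq, Complex.ofReal_pow]
  exact_mod_cast hint.trans (hexp.trans hreal.symm)

end Family

/-! ## §2  `x_j` on a finite Hermite combination: the two shifted families and their `L²` sizes -/

section CoordinateSum

variable (j : σ) (S : Finset (σ →₀ ℕ)) (c : (σ →₀ ℕ) → ℂ)

/-- The raising coefficient `a⁺_β = ½√((β_j+1)/π)` of `x_j` on `h_β`. [folklore] -/
def upCoeff (j : σ) (β : σ →₀ ℕ) : ℂ := (1 / 2 : ℂ) * (Real.sqrt ((β j + 1) / π) : ℂ)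

/-- The lowering coefficient `a⁻_β = ½√(β_j/π)` of `x_j` on `h_β` (zero when `β_j = 0`). [folklore] -/
def downCoeff (j : σ) (β : σ →₀ ℕ) : ℂ := (1 / 2 : ℂ) * (Real.sqrt (β j / π) : ℂ)

/-- **`x_j (Σ_{β∈S} c_β h_β) = Σ_β c_β a⁺_β h_{β+1_j} + Σ_β c_β a⁻_β h_{β−1_j}`**. [cite: Folland1989, (1.82)] -/
theorem coordMulCLM_sum_smul_herm :
    coordMulCLM j (∑ β ∈ S, c β • hermiteSchwartz (herm β)) =
      ∑ β ∈ S, (c β * upCoeff j β) • hermiteSchwartz (herm (β + Finsupp.single j 1)) +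
        ∑ β ∈ S, (c β * downCoeff j β) • hermiteSchwartz (herm (β - Finsupp.single j 1)) := by
  rw [map_sum, ← Finset.sum_add_distrib]
  refine Finset.sum_congr rfl fun β _ => ?_
  rw [map_smul, coordMulCLM_herm, smul_add, smul_smul, smul_smul]
  rfl

omit [Fintype σ] [DecidableEq σ] in
/-- `β ↦ β + 1_j` is injective. [folklore] -/
theorem injOn_add_single (S : Finset (σ →₀ ℕ)) (j : σ) :
    Set.InjOn (fun β : σ →₀ ℕ => β + Finsupp.single j 1) S :=
  fun _ _ _ _ h => add_right_cancel h

/-- **Parseval value of the raising piece**: `∫ ‖Σ_β c_β a⁺_β h_{β+1_j}‖² = Σ_β ‖c_β‖² (β_j+1)/(4π)`. [folklore] -/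
theorem integral_norm_sq_coordMul_up :
    ∫ x : EuclideanSpace ℝ σ,
        ‖(∑ β ∈ S, (c β * upCoeff j β) • hermiteSchwartz (herm (β + Finsupp.single j 1))) x‖ ^ 2 =
      ∑ β ∈ S, ‖c β‖ ^ 2 * (((β j : ℝ) + 1) / (4 * π)) := by
  rw [integral_norm_sq_sum_smul_herm_family S (fun β : σ →₀ ℕ => β + Finsupp.single j 1) (injOn_add_single S j)]
  refine Finset.sum_congr rfl fun β _ => ?_
  have h1 : (0 : ℝ) ≤ ((β j : ℝ) + 1) / π := by positivity
  have hhalf : ‖(1 / 2 : ℂ)‖ = 1 / 2 := by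
    rw [norm_div, norm_one, Complex.norm_ofNat]
  rw [norm_mul, mul_pow, upCoeff, norm_mul, Complex.norm_real, Real.norm_of_nonneg (Real.sqrt_nonneg _), mul_pow,
    Real.sq_sqrt h1, hhalf]
  ring

/-- **Bound for the raising piece**: if `β_j ≤ d` on `S`, then
`∫ ‖Σ_β c_β a⁺_β h_{β+1_j}‖² ≤ (d+1)/(4π) · Σ_β ‖c_β‖²`. [folklore] -/
theorem integral_norm_sq_coordMul_up_le (d : ℕ) (hd : ∀ β ∈ S, β j ≤ d) :
    ∫ x : EuclideanSpace ℝ σ,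
        ‖(∑ β ∈ S, (c β * upCoeff j β) • hermiteSchwartz (herm (β + Finsupp.single j 1))) x‖ ^ 2 ≤
      (((d : ℝ) + 1) / (4 * π)) * ∑ β ∈ S, ‖c β‖ ^ 2 := by
  rw [integral_norm_sq_coordMul_up, Finset.mul_sum]
  refine Finset.sum_le_sum fun β hβ => ?_
  rw [mul_comm]
  have hβd : ((β j : ℝ) + 1) / (4 * π) ≤ ((d : ℝ) + 1) / (4 * π) := by
    apply div_le_div_of_nonneg_right _ (by positivity)
    exact_mod_cast Nat.add_le_add_right (hd β hβ) 1
  exact mul_le_mul_of_nonneg_right hβd (by positivity)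

end CoordinateSum

end Literature.Analysis.SegalBargmann

end
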